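import Summits.Ventures.HodgeRepro2.T5SU11JacobiPhaseTailMonotone
import Summits.Ventures.HodgeRepro2.T5SU11JacobiWeightDerivAll
import Summits.Ventures.HodgeRepro2.T5SU11JacobiPhaseMomentsAsymptotic

/-!
# Positive association: any two increasing functions of the phase are positively correlated; `Cov(log|a|, t) ≥ 0`, `Cov(|g·0|², t) ≥ 0`

Chebyshev's inequality of `T5SU11JacobiPhaseTailMonotone` with `−f` in place of `f` says that two MONOTONE
functions of the phase are positively correlated under every weight `w ≥ 0` on `(0, ∞)`
(`integral_mul_mul_ge_of_monotone_monotone`: `∫ f w · ∫ g w ≤ ∫ f g w · ∫ w`), hence, in the phase variable,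

  **`⟨h₁⟩_{k,λ} ⟨h₂⟩_{k,λ} ≤ ⟨h₁ h₂⟩_{k,λ}`**   (`mean_mul_mean_le_mean_mul`)

for monotone `h₁, h₂` with the three products integrable against `e^{−(k−2)s} Φ_λ`. On the group, with the law of
the phase (`T5SU11PhaseLawLintegral.integral_phase_eq'`) and the domination `t(s) ≤ s + log 2`
(`T5SU11JacobiPhaseMomentsAsymptotic.cartanOfPhase_le`), this gives for every `λ` and every `k` on the ray

  **`Cov_{k,λ}(log|a|, t(g)) ≥ 0`** and **`Cov_{k,λ}(|g·0|², t(g)) ≥ 0`**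
  (`covariance_phase_cartan_nonneg`, `covariance_orbit_sq_cartan_nonneg`),

completing, with `T5SU11JacobiPhaseOrbitCovariance` (`Cov(log|a|, |g·0|²) ≥ 0`), the statement that the three
coordinates of the near-identity concentration of the explicit model are pairwise positively correlated at every
finite weight. Nothing is claimed about (N).

Blind lane: Mathlib + the HodgeRepro2 prefix only; no sorry; axioms ⊆ {propext, Classical.choice,
Quot.sound}.
-/

namespace Summit.Ventures.HodgeRepro2.T5SU11JacobiPhaseAssociation

open MeasureTheory MeasureTheory.Measure Metric Set Filter Topology
open T5SU11Unimodular T5SU11Fibration T5SU11Cartan T5SU11OneParameter T5SU11CartanProjection T5HaarCircle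
  T5BergmanCoefficient T5SU11FibrationHaar T5SU11SphericalFunction T5SU11SphericalSymmetry
  T5SU11SphericalBounds T5SU11SphericalContinuous T5SU11JacobiIwasawa T5SU11JacobiTransform
  T5SU11JacobiWeight T5SU11KFiniteMajorantPow T5SU11JacobiWeightDeriv T5SU11JacobiLaplacePhase
  T5SU11PhaseLawLintegral T5SU11JacobiPhaseTailGroup T5SU11JacobiWeightDerivAll
  T5SU11JacobiPhaseMomentsAsymptotic T5SU11JacobiPhaseTailMonotone
open scoped Real

/-! ### Positive association on `(0, ∞)` -/

/-- **Two monotone functions are positively correlated** under every weight `w ≥ 0` on `(0, ∞)`: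
`(∫ f w)(∫ g w) ≤ (∫ f g w)(∫ w)` (Chebyshev with `−f`). -/
theorem integral_mul_mul_ge_of_monotone_monotone {w f g : ℝ → ℝ} (hw : ∀ s, 0 ≤ w s) (hf : Monotone f)
    (hg : Monotone g) (hwi : IntegrableOn w (Ioi 0)) (hfw : IntegrableOn (fun s => f s * w s) (Ioi 0))
    (hgw : IntegrableOn (fun s => g s * w s) (Ioi 0))
    (hfgw : IntegrableOn (fun s => f s * g s * w s) (Ioi 0)) :
    (∫ s in Ioi (0 : ℝ), f s * w s) * (∫ s in Ioi (0 : ℝ), g s * w s)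
      ≤ (∫ s in Ioi (0 : ℝ), f s * g s * w s) * (∫ s in Ioi (0 : ℝ), w s) := by
  have hfa : Antitone fun s => -f s := fun s t hst => neg_le_neg (hf hst)
  have hfw' : IntegrableOn (fun s => (-f s) * w s) (Ioi 0) := by
    refine hfw.neg.congr_fun (fun s _ => ?_) measurableSet_Ioi
    simp only [Pi.neg_apply]
    ring
  have hfgw' : IntegrableOn (fun s => (-f s) * g s * w s) (Ioi 0) := by
    refine hfgw.neg.congr_fun (fun s _ => ?_) measurableSet_Ioi
    simp only [Pi.neg_apply]
    ring
  have h := integral_mul_mul_le_of_antitone_monotone hw hfa hg hwi hfw' hgw hfgw'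
  have e1 : ∫ s in Ioi (0 : ℝ), (-f s) * g s * w s = -∫ s in Ioi (0 : ℝ), f s * g s * w s := by
    rw [← integral_neg]
    exact setIntegral_congr_fun measurableSet_Ioi fun s _ => by ring
  have e2 : ∫ s in Ioi (0 : ℝ), (-f s) * w s = -∫ s in Ioi (0 : ℝ), f s * w s := by
    rw [← integral_neg]
    exact setIntegral_congr_fun measurableSet_Ioi fun s _ => by ring
  rw [e1, e2] at h
  linarith

section measure

variable [MeasurableSpace Circle] [BorelSpace Circle]

/-- **Positive association in the phase variable**: for `k` on the ray, monotone `h₁, h₂` with `h₁ w`, `h₂ w`,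
`h₁ h₂ w` integrable against `w = e^{−(k−2)s} Φ_λ` on `(0, ∞)`,
`(∫ h₁ w / ∫ w)(∫ h₂ w / ∫ w) ≤ ∫ h₁ h₂ w / ∫ w`. -/
theorem mean_mul_mean_le_mean_mul {k lam : ℝ} (hk : 1 < k) (h1 : lam < k) (h2 : 2 < k + lam)
    {h₁ h₂ : ℝ → ℝ} (hm₁ : Monotone h₁) (hm₂ : Monotone h₂)
    (hi₁ : IntegrableOn (fun s => h₁ s * (Real.exp (-((k - 2) * s)) * sphPhase lam s)) (Ioi 0))
    (hi₂ : IntegrableOn (fun s => h₂ s * (Real.exp (-((k - 2) * s)) * sphPhase lam s)) (Ioi 0))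
    (hi₁₂ : IntegrableOn (fun s => h₁ s * h₂ s * (Real.exp (-((k - 2) * s)) * sphPhase lam s)) (Ioi 0)) :
    ((∫ s in Ioi (0 : ℝ), h₁ s * (Real.exp (-((k - 2) * s)) * sphPhase lam s))
        / (∫ s in Ioi (0 : ℝ), Real.exp (-((k - 2) * s)) * sphPhase lam s))
      * ((∫ s in Ioi (0 : ℝ), h₂ s * (Real.exp (-((k - 2) * s)) * sphPhase lam s))
        / (∫ s in Ioi (0 : ℝ), Real.exp (-((k - 2) * s)) * sphPhase lam s))
      ≤ (∫ s in Ioi (0 : ℝ), h₁ s * h₂ s * (Real.exp (-((k - 2) * s)) * sphPhase lam s))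
        / (∫ s in Ioi (0 : ℝ), Real.exp (-((k - 2) * s)) * sphPhase lam s) := by
  set w : ℝ → ℝ := fun s => Real.exp (-((k - 2) * s)) * sphPhase lam s with hw
  have hw0 : ∀ s, 0 ≤ w s := fun s => mul_nonneg (Real.exp_pos _).le (sphPhase_pos lam s).le
  have hwi : IntegrableOn w (Ioi 0) := integrableOn_exp_mul_sphPhase hk h1 h2
  have hN : 0 < ∫ s in Ioi (0 : ℝ), w s := by
    have := jacobi_pos hk h1 h2
    rw [jacobi_eq_laplace_phase hk h1 h2] at this
    exact pos_of_mul_pos_right this (by positivity)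
  have key := integral_mul_mul_ge_of_monotone_monotone hw0 hm₁ hm₂ hwi hi₁ hi₂ hi₁₂
  rw [div_mul_div_comm, div_le_div_iff₀ (by positivity) hN]
  calc (∫ s in Ioi (0 : ℝ), h₁ s * w s) * (∫ s in Ioi (0 : ℝ), h₂ s * w s) * (∫ s in Ioi (0 : ℝ), w s)
      ≤ (∫ s in Ioi (0 : ℝ), h₁ s * h₂ s * w s) * (∫ s in Ioi (0 : ℝ), w s) * (∫ s in Ioi (0 : ℝ), w s) :=
        mul_le_mul_of_nonneg_right key hN.le
    _ = (∫ s in Ioi (0 : ℝ), h₁ s * h₂ s * w s) * ((∫ s in Ioi (0 : ℝ), w s) * (∫ s in Ioi (0 : ℝ), w s)) := by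
        ring

/-! ### Transfer to the group: integrals of functions of the phase -/

/-- For continuous `F ≥ 0` on `[0, ∞)` with `F(s) e^{−(k−2)s} Φ_λ(s)` integrable on `(0, ∞)`,
`∫_G F(log|a|) m_k φ_λ dν = 2π ∫_0^∞ F(s) e^{−(k−2)s} Φ_λ(s) ds`. -/
theorem integral_fun_phase_mul_eq {F : ℝ → ℝ} (hF : Continuous F) (hF0 : ∀ s, 0 ≤ s → 0 ≤ F s) (k lam : ℝ)
    (hi : IntegrableOn (fun s => F s * (Real.exp (-((k - 2) * s)) * sphPhase lam s)) (Ioi 0)) :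
    ∫ g, F (Real.log ‖mat g 0 0‖) * ((1 - ‖orbit g‖ ^ 2) ^ (k / 2) * sph lam g) ∂(nu haarCircle)
      = 2 * π * ∫ s in Ioi (0 : ℝ), F s * (Real.exp (-((k - 2) * s)) * sphPhase lam s) := by
  set G : ℝ → ℝ := fun s => F s * (Real.exp (-(k * s)) * sphPhase lam s) with hG
  have hGc : Continuous G :=
    hF.mul ((Real.continuous_exp.comp (continuous_const.mul continuous_id).neg).mul (continuous_sphPhase lam))
  have hG0 : ∀ s, 0 ≤ s → 0 ≤ G s := fun s hs =>
    mul_nonneg (hF0 s hs) (mul_nonneg (Real.exp_pos _).le (sphPhase_pos lam s).le)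
  have e : ∀ s : ℝ, G s * Real.exp (2 * s) = F s * (Real.exp (-((k - 2) * s)) * sphPhase lam s) := fun s => by
    simp only [hG]
    rw [show F s * (Real.exp (-(k * s)) * sphPhase lam s) * Real.exp (2 * s)
        = F s * ((Real.exp (-(k * s)) * Real.exp (2 * s)) * sphPhase lam s) by ring, ← Real.exp_add]
    congr 3
    ring
  have hR : IntegrableOn (fun s => G s * Real.exp (2 * s)) (Ioi 0) := by
    simp_rw [e]
    exact hi
  have h := integral_phase_eq' hGc hG0 hR
  simp_rw [e] at h
  rw [← h]
  refine integral_congr_ae (Filter.Eventually.of_forall fun g => ?_)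
  simp only [hG]
  rw [orbit_rpow_eq_exp, sph_eq_sphPhase]

/-- `s e^{−(k−2)s} Φ_λ` and `s² e^{−(k−2)s} Φ_λ` are integrable on `(0, ∞)` for `k` on the ray. -/
theorem integrableOn_pow_mul_exp_mul_sphPhase' (n : ℕ) {k lam : ℝ} (hk : 1 < k) (h1 : lam < k)
    (h2 : 2 < k + lam) :
    IntegrableOn (fun s : ℝ => s ^ n * (Real.exp (-((k - 2) * s)) * sphPhase lam s)) (Ioi 0) := by
  have hF : Continuous fun s : ℝ => s ^ n * Real.exp (-(k * s)) * sphPhase lam s :=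
    ((continuous_id.pow n).mul (Real.continuous_exp.comp (continuous_const.mul continuous_id).neg)).mul
      (continuous_sphPhase lam)
  have hF0 : ∀ s, 0 ≤ s → 0 ≤ s ^ n * Real.exp (-(k * s)) * sphPhase lam s := fun s hs =>
    mul_nonneg (mul_nonneg (pow_nonneg hs n) (Real.exp_pos _).le) (sphPhase_pos lam s).le
  have hint : Integrable (fun g => (fun s : ℝ => s ^ n * Real.exp (-(k * s)) * sphPhase lam s)
      (Real.log ‖mat g 0 0‖)) (nu haarCircle) := by
    refine (integrable_log_pow_mul_orbit_rpow_mul_sph hk h1 h2 n).congr (Filter.Eventually.of_forall fun g => ?_)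
    simp only
    rw [orbit_rpow_eq_exp, sph_eq_sphPhase, mul_assoc]
  have h := (integrable_phase_iff hF hF0).mp hint
  refine h.congr_fun (fun s _ => ?_) measurableSet_Ioi
  show s ^ n * Real.exp (-(k * s)) * sphPhase lam s * Real.exp (2 * s)
    = s ^ n * (Real.exp (-((k - 2) * s)) * sphPhase lam s)
  rw [show s ^ n * Real.exp (-(k * s)) * sphPhase lam s * Real.exp (2 * s)
      = s ^ n * ((Real.exp (-(k * s)) * Real.exp (2 * s)) * sphPhase lam s) by ring, ← Real.exp_add]
  congr 3
  ring

/-- `t(s) e^{−(k−2)s} Φ_λ` is integrable on `(0, ∞)` (`t(s) ≤ s + log 2`). -/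
theorem integrableOn_cartanOfPhase_mul {k lam : ℝ} (hk : 1 < k) (h1 : lam < k) (h2 : 2 < k + lam) :
    IntegrableOn (fun s : ℝ => cartanOfPhase s * (Real.exp (-((k - 2) * s)) * sphPhase lam s)) (Ioi 0) := by
  have hd : IntegrableOn (fun s : ℝ => (s + Real.log 2) * (Real.exp (-((k - 2) * s)) * sphPhase lam s)) (Ioi 0) := by
    have ha := integrableOn_pow_mul_exp_mul_sphPhase' 1 hk h1 h2
    have hb := (integrableOn_exp_mul_sphPhase hk h1 h2).const_mul (Real.log 2)
    refine (ha.add hb).congr_fun (fun s _ => ?_) measurableSet_Ioi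
    simp only [Pi.add_apply, pow_one]
    ring
  refine hd.mono' ?_ ?_
  · exact (continuous_cartanOfPhase.mul ((Real.continuous_exp.comp (continuous_const.mul continuous_id).neg).mul
      (continuous_sphPhase lam))).aestronglyMeasurable
  · filter_upwards [ae_restrict_mem measurableSet_Ioi] with s hs
    have hs0 : 0 ≤ s := le_of_lt hs
    have hw0 : 0 ≤ Real.exp (-((k - 2) * s)) * sphPhase lam s :=
      mul_nonneg (Real.exp_pos _).le (sphPhase_pos lam s).le
    rw [Real.norm_of_nonneg (mul_nonneg (cartanOfPhase_nonneg s) hw0)]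
    exact mul_le_mul_of_nonneg_right (cartanOfPhase_le hs0) hw0

/-- `s t(s) e^{−(k−2)s} Φ_λ` is integrable on `(0, ∞)`. -/
theorem integrableOn_mul_cartanOfPhase_mul {k lam : ℝ} (hk : 1 < k) (h1 : lam < k) (h2 : 2 < k + lam) :
    IntegrableOn (fun s : ℝ => s * cartanOfPhase s * (Real.exp (-((k - 2) * s)) * sphPhase lam s)) (Ioi 0) := by
  have hd : IntegrableOn (fun s : ℝ => (s ^ 2 + Real.log 2 * s) * (Real.exp (-((k - 2) * s)) * sphPhase lam s))
      (Ioi 0) := by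
    have ha := integrableOn_pow_mul_exp_mul_sphPhase' 2 hk h1 h2
    have hb := (integrableOn_pow_mul_exp_mul_sphPhase' 1 hk h1 h2).const_mul (Real.log 2)
    refine (ha.add hb).congr_fun (fun s _ => ?_) measurableSet_Ioi
    simp only [Pi.add_apply, pow_one]
    ring
  refine hd.mono' ?_ ?_
  · exact ((continuous_id.mul continuous_cartanOfPhase).mul
      ((Real.continuous_exp.comp (continuous_const.mul continuous_id).neg).mul
        (continuous_sphPhase lam))).aestronglyMeasurable
  · filter_upwards [ae_restrict_mem measurableSet_Ioi] with s hs
    have hs0 : 0 ≤ s := le_of_lt hs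
    have hw0 : 0 ≤ Real.exp (-((k - 2) * s)) * sphPhase lam s :=
      mul_nonneg (Real.exp_pos _).le (sphPhase_pos lam s).le
    rw [Real.norm_of_nonneg (mul_nonneg (mul_nonneg hs0 (cartanOfPhase_nonneg s)) hw0)]
    refine mul_le_mul_of_nonneg_right ?_ hw0
    have := cartanOfPhase_le hs0
    nlinarith

/-! ### The covariances on the group -/

/-- **`Cov_{k,λ}(log|a|, t(g)) ≥ 0`**: on the ray, for every `λ`,
`⟨log|a|⟩_{k,λ} ⟨t⟩_{k,λ} ≤ ⟨log|a| · t⟩_{k,λ}`. -/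
theorem covariance_phase_cartan_nonneg {k lam : ℝ} (hk : 1 < k) (h1 : lam < k) (h2 : 2 < k + lam) :
    ((∫ g, Real.log ‖mat g 0 0‖ * ((1 - ‖orbit g‖ ^ 2) ^ (k / 2) * sph lam g) ∂(nu haarCircle))
        / (∫ g, (1 - ‖orbit g‖ ^ 2) ^ (k / 2) * sph lam g ∂(nu haarCircle)))
      * ((∫ g, cartanT g * ((1 - ‖orbit g‖ ^ 2) ^ (k / 2) * sph lam g) ∂(nu haarCircle))
        / (∫ g, (1 - ‖orbit g‖ ^ 2) ^ (k / 2) * sph lam g ∂(nu haarCircle)))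
      ≤ (∫ g, Real.log ‖mat g 0 0‖ * cartanT g * ((1 - ‖orbit g‖ ^ 2) ^ (k / 2) * sph lam g) ∂(nu haarCircle))
        / (∫ g, (1 - ‖orbit g‖ ^ 2) ^ (k / 2) * sph lam g ∂(nu haarCircle)) := by
  have hi₁ := integrableOn_pow_mul_exp_mul_sphPhase' 1 hk h1 h2
  simp only [pow_one] at hi₁
  have hi₂ := integrableOn_cartanOfPhase_mul hk h1 h2
  have hi₁₂ := integrableOn_mul_cartanOfPhase_mul hk h1 h2
  have hm₁ : Monotone fun s : ℝ => s := fun _ _ h => h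
  have hm₂ : Monotone cartanOfPhase := by
    intro s t hst
    unfold cartanOfPhase
    apply Real.arsinh_le_arsinh.mpr
    apply Real.sqrt_le_sqrt
    have := Real.exp_le_exp.mpr (by linarith : 2 * s ≤ 2 * t)
    linarith
  have key := mean_mul_mean_le_mean_mul hk h1 h2 hm₁ hm₂ hi₁ hi₂ hi₁₂
  -- transfer the three integrals to the group
  have e1 := integral_fun_phase_mul_eq (F := fun s => s) continuous_id (fun s hs => hs) k lam hi₁
  have e2 := integral_fun_phase_mul_eq (F := cartanOfPhase) continuous_cartanOfPhase
    (fun s _ => cartanOfPhase_nonneg s) k lam hi₂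
  have e3 := integral_fun_phase_mul_eq (F := fun s => s * cartanOfPhase s)
    (continuous_id.mul continuous_cartanOfPhase) (fun s hs => mul_nonneg hs (cartanOfPhase_nonneg s)) k lam hi₁₂
  simp only [cartanOfPhase_log] at e1 e2 e3
  rw [e1, e2, e3, jacobi_eq_laplace_phase hk h1 h2, mul_div_mul_left _ _ (by positivity : (2 * π : ℝ) ≠ 0),
    mul_div_mul_left _ _ (by positivity : (2 * π : ℝ) ≠ 0),
    mul_div_mul_left _ _ (by positivity : (2 * π : ℝ) ≠ 0)]
  exact key

/-- **`Cov_{k,λ}(|g·0|², t(g)) ≥ 0`**: on the ray, for every `λ`,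
`⟨|g·0|²⟩_{k,λ} ⟨t⟩_{k,λ} ≤ ⟨|g·0|² · t⟩_{k,λ}`. -/
theorem covariance_orbit_sq_cartan_nonneg {k lam : ℝ} (hk : 1 < k) (h1 : lam < k) (h2 : 2 < k + lam) :
    ((∫ g, ‖orbit g‖ ^ 2 * ((1 - ‖orbit g‖ ^ 2) ^ (k / 2) * sph lam g) ∂(nu haarCircle))
        / (∫ g, (1 - ‖orbit g‖ ^ 2) ^ (k / 2) * sph lam g ∂(nu haarCircle)))
      * ((∫ g, cartanT g * ((1 - ‖orbit g‖ ^ 2) ^ (k / 2) * sph lam g) ∂(nu haarCircle))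
        / (∫ g, (1 - ‖orbit g‖ ^ 2) ^ (k / 2) * sph lam g ∂(nu haarCircle)))
      ≤ (∫ g, ‖orbit g‖ ^ 2 * cartanT g * ((1 - ‖orbit g‖ ^ 2) ^ (k / 2) * sph lam g) ∂(nu haarCircle))
        / (∫ g, (1 - ‖orbit g‖ ^ 2) ^ (k / 2) * sph lam g ∂(nu haarCircle)) := by
  -- `|g·0|² = 1 − e^{−2s}` is a bounded monotone function of the phase
  set R : ℝ → ℝ := fun s => 1 - Real.exp (-(2 * s)) with hR
  have hRc : Continuous R := continuous_const.sub (Real.continuous_exp.comp (continuous_const.mul continuous_id).neg)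
  have hR0 : ∀ s, 0 ≤ s → 0 ≤ R s := fun s hs => by
    simp only [hR]
    have := Real.exp_le_one_iff.mpr (by linarith : -(2 * s) ≤ 0)
    linarith
  have hR1 : ∀ s, R s ≤ 1 := fun s => by
    simp only [hR]
    have := Real.exp_pos (-(2 * s))
    linarith
  have hRm : Monotone R := fun s t hst => by
    simp only [hR]
    have := Real.exp_le_exp.mpr (by linarith : -(2 * t) ≤ -(2 * s))
    linarith
  have hRg : ∀ g : SU11, R (Real.log ‖mat g 0 0‖) = ‖orbit g‖ ^ 2 := fun g => by
    simp only [hR]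
    have := orbit_rpow_eq_exp 2 g
    rw [show (2 : ℝ) / 2 = 1 by norm_num, Real.rpow_one] at this
    linarith
  have hwi := integrableOn_exp_mul_sphPhase hk h1 h2
  have hi₁ : IntegrableOn (fun s => R s * (Real.exp (-((k - 2) * s)) * sphPhase lam s)) (Ioi 0) := by
    refine hwi.mono' ?_ ?_
    · exact (hRc.mul ((Real.continuous_exp.comp (continuous_const.mul continuous_id).neg).mul
        (continuous_sphPhase lam))).aestronglyMeasurable
    · filter_upwards [ae_restrict_mem measurableSet_Ioi] with s hs
      have hw0 : 0 ≤ Real.exp (-((k - 2) * s)) * sphPhase lam s :=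
        mul_nonneg (Real.exp_pos _).le (sphPhase_pos lam s).le
      rw [Real.norm_of_nonneg (mul_nonneg (hR0 s (le_of_lt hs)) hw0)]
      exact mul_le_of_le_one_left hw0 (hR1 s)
  have hi₂ := integrableOn_cartanOfPhase_mul hk h1 h2
  have hi₁₂ : IntegrableOn (fun s => R s * cartanOfPhase s * (Real.exp (-((k - 2) * s)) * sphPhase lam s))
      (Ioi 0) := by
    refine hi₂.mono' ?_ ?_
    · exact ((hRc.mul continuous_cartanOfPhase).mul
        ((Real.continuous_exp.comp (continuous_const.mul continuous_id).neg).mul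
          (continuous_sphPhase lam))).aestronglyMeasurable
    · filter_upwards [ae_restrict_mem measurableSet_Ioi] with s hs
      have hw0 : 0 ≤ Real.exp (-((k - 2) * s)) * sphPhase lam s :=
        mul_nonneg (Real.exp_pos _).le (sphPhase_pos lam s).le
      have ht0 := cartanOfPhase_nonneg s
      rw [Real.norm_of_nonneg (mul_nonneg (mul_nonneg (hR0 s (le_of_lt hs)) ht0) hw0)]
      refine mul_le_mul_of_nonneg_right ?_ hw0
      exact mul_le_of_le_one_left ht0 (hR1 s)
  have hm₂ : Monotone cartanOfPhase := by
    intro s t hst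
    unfold cartanOfPhase
    apply Real.arsinh_le_arsinh.mpr
    apply Real.sqrt_le_sqrt
    have := Real.exp_le_exp.mpr (by linarith : 2 * s ≤ 2 * t)
    linarith
  have key := mean_mul_mean_le_mean_mul hk h1 h2 hRm hm₂ hi₁ hi₂ hi₁₂
  have e1 := integral_fun_phase_mul_eq (F := R) hRc hR0 k lam hi₁
  have e2 := integral_fun_phase_mul_eq (F := cartanOfPhase) continuous_cartanOfPhase
    (fun s _ => cartanOfPhase_nonneg s) k lam hi₂
  have e3 := integral_fun_phase_mul_eq (F := fun s => R s * cartanOfPhase s) (hRc.mul continuous_cartanOfPhase)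
    (fun s hs => mul_nonneg (hR0 s hs) (cartanOfPhase_nonneg s)) k lam hi₁₂
  simp only [cartanOfPhase_log, hRg] at e1 e2 e3
  rw [e1, e2, e3, jacobi_eq_laplace_phase hk h1 h2, mul_div_mul_left _ _ (by positivity : (2 * π : ℝ) ≠ 0),
    mul_div_mul_left _ _ (by positivity : (2 * π : ℝ) ≠ 0),
    mul_div_mul_left _ _ (by positivity : (2 * π : ℝ) ≠ 0)]
  exact key

end measure

end Summit.Ventures.HodgeRepro2.T5SU11JacobiPhaseAssociation
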